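import Summits.ResolutionOfSingularities.ResolutionOfSingularities.Theorems.HilbertSamuelEliminationSigmaMaxModificationsCorridor3CPFrameWeightedMinExponents
import Literature.AlgebraicGeometry.Resolution.ArithmeticalThreefoldsLocalPolyhedronProofs
import Literature.RingTheory.HilbertSamuel.MinimalPrimesCodim
import HarnessLib

/-!
# [OURS · L1 W4.2] D18 — FACE VERTEX in ANY codimension: `h ≡ (X − λ)^m (mod (u_T))` with `λ ∉ (u_T)` contradicts the minimality of
# `Δ(h; u; X)` — Cossart–Piltant 2019 Prop. 2.3 over the generic point of `V(u_T)`, derived from FULL minimality (the lifting step of Prop. 2.4)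
# (cell res-hironaka, LADDER-RESOLUTION rung L; slot W4.2, crux chain w42 `SigmaMaxModificationsCorridor3` stmt-ResolutionOfSingularities-19249;
# `--supports stmt-ResolutionOfSingularities-19249 --as helper`; res-L1-w42-plan-1 RULING v3.14-44 (KQ)(1) «|J| = 1 needs Prop 2.4 (2)»; hand
# res-D-brk-3 (gen 7), file F1d: REMOVES the projected-minimality hypothesis of p557353 / the NEED-FACT of 18:25:05Z)

PURE COMMUTATIVE ALGEBRA, 0 `def`s, every declaration PROVED; OURS bookkeeping; NOT a statement of Hironaka's manuscript [Hironaka2017] nor of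
[CossartPiltant2019]/[CossartJannsenSaito2020]. AI-written, weaker than expert review.

* **`mem_span_image_of_isMinimal_of_coeff_sub_mem`** — `R` equicharacteristic regular local with r.s.p. `u`, `h` of degree `m ≥ 1` with `Δ(h; u; X)`
  MINIMAL, `T` ANY set of indices, and `coeff_{m−j} h ≡ C(m,j)(−λ)^j (mod (u_T))` for `1 ≤ j ≤ m` ⟹ `λ ∈ (u_T)`.
  Proof (CP 2019 Prop. 2.4, proof, arXiv v1 p. 12, made explicit): expand `λ̄` in the regular local ring `R/(u_T)` along the parameters
  `ū_{T'}` (Prop. 2.1); pick the minimal exponent `x'` for a digit weight (unique minimiser), `λ ≡ c·u^{x'} + (higher weight)`, `c` a unit; with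
  the weight `β = (L on T, digits on T')` every `f_j` lies in `C(m,j)(−c)^j u^{j x'} + I_β(j·|x'|_β + 1)`, so `x'` (extended by `0` on `T`) is
  a SOLVABLE VERTEX of `Δ(h; u; X)` — contradiction.

References: CP 2019 = arXiv:1412.0868v1, Prop. 2.1, Def. 2.3–2.4, Prop. 2.3–2.4 (pp. 10–12) [CossartPiltant2019]; tree
`Literature…CharPolyhedronSolvableVertex`, `…MonomialIdealsRegularParameters`, `…ArithmeticalThreefoldsLocalPolyhedronProofs` ((2.6) extend API).
-/

noncomputable section

set_option linter.dupNamespace false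

open IsLocalRing Polynomial Finset
open Literature.AlgebraicGeometry.Resolution Literature.AlgebraicGeometry.Resolution.CossartPiltant

universe u

namespace Summit.ResolutionOfSingularities.ResolutionOfSingularities.Theorems.SigmaMaxModificationsCorridor3.Helpers

/-! ## §3. The face vertex in any codimension -/

section Main

variable {R : Type u} [CommRing R] [IsRegularLocalRing R]

set_option maxHeartbeats 800000 in
-- a long elementary assembly (expansions, weights, the solvable vertex)
/-- [OURS · L1 W4.2] **CP 2019 Prop. 2.3 over the generic point of ANY face, from FULL minimality** (the lifting argument of Prop. 2.4 made
explicit): `R` equicharacteristic regular local with r.s.p. `u`, `h` of degree `m ≥ 1`, `Δ(h; u; X)` minimal, `T` any set of indices, and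
`coeff_{m−j} h ≡ C(m,j)(−λ)^j (mod (u_T))` for `1 ≤ j ≤ m` ⟹ `λ ∈ (u_T)`. [cite: CossartPiltant2019, Prop. 2.1, Def. 2.3–2.4, Prop. 2.3–2.4 (arXiv v1 pp. 10–12)] -/
theorem mem_span_image_of_isMinimal_of_coeff_sub_mem (hchar : ∀ k : ℕ, (k : R) ≠ 0 → IsUnit (k : R))
    {n : ℕ} (hdim : ringKrullDim R = n) (u : Fin n → R) (hu : Ideal.span (Set.range u) = maximalIdeal R)
    {h : R[X]} (hm : 0 < h.natDegree) (hmin : IsMinimal u h) (T : Finset (Fin n)) {lam : R}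
    (hcoef : ∀ j ∈ Finset.Icc 1 h.natDegree,
      h.coeff (h.natDegree - j) - (h.natDegree.choose j : R) * (-lam) ^ j ∈ Ideal.span (u '' ↑T)) :
    lam ∈ Ideal.span (u '' ↑T) := by
  classical
  set m := h.natDegree with hmdef
  -- the sub-families `z = u|_T`, `v = u|_{Tᶜ}`
  set eT := T.orderEmbOfFin rfl with heT
  set eC := Tᶜ.orderEmbOfFin rfl with heC
  have hιC : Function.Injective (fun i => eC i) := eC.injective
  set z : Fin T.card → R := u ∘ (fun i => eT i) with hz
  set v : Fin Tᶜ.card → R := u ∘ (fun i => eC i) with hv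
  have hzr : Set.range z = u '' ↑T := by
    rw [hz, Set.range_comp]; exact congrArg _ (Finset.range_orderEmbOfFin T rfl)
  have heCmem : ∀ k, (eC k : Fin n) ∉ T := fun k => Finset.mem_compl.mp (by
    have : (eC k : Fin n) ∈ Set.range (fun i => eC i) := ⟨k, rfl⟩
    rw [Finset.range_orderEmbOfFin] at this
    exact this)
  have heCsurj : ∀ j, j ∉ T → ∃ k, (eC k : Fin n) = j := fun j hj => by
    have : j ∈ Set.range (fun i => eC i) := by rw [Finset.range_orderEmbOfFin]; exact Finset.mem_compl.mpr hj
    exact this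
  rw [← hzr] at hcoef ⊢
  set 𝔭 := Ideal.span (Set.range z) with h𝔭
  have hzu : IsRsopPart u := ⟨‹_›, 0, Fin.elim0, by rw [hdim, Nat.add_zero], by rw [← hu]; congr 1; ext x; simp⟩
  have hzT : IsRsopPart z := hzu.comp _ eT.injective
  have hprime : 𝔭.IsPrime := hzT.isPrime_span_range
  have h𝔭le : 𝔭 ≤ maximalIdeal R := hzT.span_range_le_maximalIdeal
  have hzmem : ∀ t ∈ T, u t ∈ 𝔭 := fun t ht => by
    rw [h𝔭, hzr]; exact Ideal.subset_span ⟨t, ht, rfl⟩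
  by_contra hlam
  -- the regular local ring `D = R/𝔭` with r.s.p. `ū|_{Tᶜ}`
  set D := R ⧸ 𝔭 with hD
  haveI : IsDomain D := Ideal.Quotient.isDomain 𝔭
  haveI hregD : IsRegularLocalRing D := hzT.isRegularLocalRing_quotient
  have hmk𝔪 : ∀ x : R, Ideal.Quotient.mk 𝔭 x ∈ maximalIdeal D ↔ x ∈ maximalIdeal R := by
    intro x
    rw [IsLocalRing.mem_maximalIdeal, IsLocalRing.mem_maximalIdeal, mem_nonunits_iff, mem_nonunits_iff, not_iff_not]
    constructor
    · intro hx
      obtain ⟨y, hy⟩ := hx.exists_right_inv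
      obtain ⟨y, rfl⟩ := Ideal.Quotient.mk_surjective y
      rw [← map_mul, ← map_one (Ideal.Quotient.mk 𝔭), Ideal.Quotient.eq] at hy
      have hy' : 1 - x * y ∈ 𝔭 := by
        have := 𝔭.neg_mem hy
        rwa [neg_sub] at this
      have h1 : IsUnit (x * y) := by
        have := IsLocalRing.isUnit_one_sub_self_of_mem_nonunits (1 - x * y) ((IsLocalRing.mem_maximalIdeal _).mp (h𝔭le hy'))
        simpa using this
      exact isUnit_of_mul_isUnit_left h1
    · exact fun hx => hx.map _
  set ub : Fin Tᶜ.card → D := Ideal.Quotient.mk 𝔭 ∘ v with hub'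
  have hspanD : Ideal.span (Set.range ub) = maximalIdeal D := by
    apply le_antisymm
    · rw [Ideal.span_le]
      rintro _ ⟨k, rfl⟩
      exact (hmk𝔪 _).mpr (hzu.mem_maximalIdeal _)
    · intro x hx
      obtain ⟨x, rfl⟩ := Ideal.Quotient.mk_surjective x
      have hx' : x ∈ Ideal.span (Set.range u) := hu ▸ (hmk𝔪 x).mp hx
      have hle : (Ideal.span (Set.range u)).map (Ideal.Quotient.mk 𝔭) ≤ Ideal.span (Set.range ub) := by
        rw [Ideal.map_span, Ideal.span_le]
        rintro _ ⟨_, ⟨j, rfl⟩, rfl⟩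
        by_cases hj : j ∈ T
        · rw [SetLike.mem_coe, Ideal.Quotient.eq_zero_iff_mem.mpr (hzmem j hj)]; exact zero_mem _
        · obtain ⟨k, hk⟩ := heCsurj j hj
          exact Ideal.subset_span ⟨k, by simp [hub', hv, hk]⟩
      exact hle (Ideal.mem_map_of_mem _ hx')
  have hdimD : ringKrullDim D = ((Tᶜ.card + 0 : ℕ) : WithBot ℕ∞) := by
    have h1 := hzT.ringKrullDim_quotient_add
    rw [hdim] at h1
    haveI : Nontrivial D := Ideal.Quotient.nontrivial_iff.mpr hzT.span_range_ne_top
    obtain ⟨d, hd⟩ : ∃ d : ℕ, ringKrullDim D = d := Literature.RingTheory.HilbertSamuel.exists_nat_eq_of_ne_bot_of_ne_top ringKrullDim_ne_bot ringKrullDim_ne_top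
    rw [hd] at h1 ⊢
    have h2 : d + T.card = n := by exact_mod_cast h1
    have h3 := Finset.card_compl T
    rw [Fintype.card_fin] at h3
    exact_mod_cast (show d = Tᶜ.card + 0 by omega)
  have hub : IsRsopPart ub := ⟨hregD, 0, Fin.elim0, hdimD, by rw [← hspanD]; congr 1; ext x; simp⟩
  -- the expansion of `λ̄` along `ū|_{Tᶜ}`
  set lb := Ideal.Quotient.mk 𝔭 lam with hlb
  have hlb0 : lb ≠ 0 := fun h0 => hlam (Ideal.Quotient.eq_zero_iff_mem.mp h0)
  obtain ⟨hantiΛ, hmemΛ, hrefΛ⟩ := hub.minExponents_spec lb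
  set Λ := minExponents ub lb with hΛ
  have hΛne : Λ.Nonempty := by
    rw [Finset.nonempty_iff_ne_empty, Ne, hΛ, minExponents_eq_empty_iff ub hub.mem_span_image_of_mul_mem hub.mem_maximalIdeal]
    exact hlb0
  obtain ⟨γb, hγb⟩ := exists_expansion_minExponents ub hmemΛ
  have hγbunit : ∀ a ∈ Λ, IsUnit (γb a) := fun a ha => by
    by_contra hnu
    exact coeff_not_mem_of_minimal ub hantiΛ hrefΛ hγb a ha (hspanD ▸ (IsLocalRing.mem_maximalIdeal _).mpr hnu)
  -- digit weights: `x'` the unique minimiser over `Λ`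
  set M : ℕ := 1 + ∑ a ∈ Λ, ∑ k, a k with hMdef
  have hM : ∀ a ∈ Λ, ∀ k, a k < M := fun a ha k => by
    have h1 : a k ≤ ∑ k', a k' := Finset.single_le_sum (f := a) (fun _ _ => Nat.zero_le _) (Finset.mem_univ k)
    have h2 : ∑ k', a k' ≤ ∑ a' ∈ Λ, ∑ k', a' k' := Finset.single_le_sum (f := fun a' => ∑ k', a' k') (fun _ _ => Nat.zero_le _) ha
    omega
  let wdig : (Fin Tᶜ.card → ℕ) → ℕ := fun a => ∑ k, a k * M ^ (k : ℕ)
  obtain ⟨x', hx'Λ, hx'min⟩ := Λ.exists_min_image wdig hΛne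
  have hx'uniq : ∀ a ∈ Λ, a ≠ x' → wdig x' < wdig a := fun a ha hne =>
    lt_of_le_of_ne (hx'min a ha) fun heq => hne (sum_mul_pow_injective_of_lt (hM a ha) (hM x' hx'Λ) heq.symm)
  set w : ℕ := wdig x' with hwdef
  -- lifts of the coefficients; the leading unit `c`
  have hlift : ∀ a, ∃ g : R, Ideal.Quotient.mk 𝔭 g = γb a := fun a => Ideal.Quotient.mk_surjective (γb a)
  choose γ hγ using hlift
  set c := γ x' with hcdef
  have hcunit : IsUnit c := by
    by_contra hcu
    have : Ideal.Quotient.mk 𝔭 c ∈ maximalIdeal D := (hmk𝔪 c).mpr ((IsLocalRing.mem_maximalIdeal _).mpr hcu)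
    rw [hcdef, hγ] at this
    exact (IsLocalRing.mem_maximalIdeal _).mp this (hγbunit x' hx'Λ)
  -- exponents extended by zero on `T`
  let ext : (Fin Tᶜ.card → ℕ) → (Fin n → ℕ) := fun a => Function.extend (fun i => eC i) a 0
  have hextT : ∀ a, ∀ t ∈ T, ext a t = 0 := fun a t ht => by
    have : ¬ ∃ k, (fun i => (eC i : Fin n)) k = t := fun ⟨k, hk⟩ => heCmem k (by
      have hk' : (eC k : Fin n) = t := hk
      rw [hk']; exact ht)
    simp only [ext, Function.extend_apply' _ _ _ this, Pi.zero_apply]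
  have hextC : ∀ a k, ext a (eC k) = a k := fun a k => hιC.extend_apply _ _ _
  have huPow_ext : ∀ a, uPow u (ext a) = uPow v a := fun a => (uPow_comp_eq_uPow_extend u hιC a).symm
  have hmk_uPow : ∀ a, Ideal.Quotient.mk 𝔭 (uPow v a) = uPow ub a := fun a => by rw [map_uPow]
  have hlamdec : lam - ∑ a ∈ Λ, γ a * uPow u (ext a) ∈ 𝔭 := by
    rw [← Ideal.Quotient.eq_zero_iff_mem, map_sub, map_sum]
    simp only [map_mul, hγ, huPow_ext, hmk_uPow]
    rw [← hγb, sub_self]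
  -- the weight vector `β = (L on T, M^k on Tᶜ)` and its integer values
  set L : ℕ := m * w + 1 with hLdef
  let βC : Fin n → ℝ := Function.extend (fun i => eC i) (fun k => ((M : ℝ)) ^ (k : ℕ)) 0
  let β : Fin n → ℝ := fun j => if j ∈ T then (L : ℝ) else βC j
  have hβT : ∀ t ∈ T, β t = L := fun t ht => by simp [β, ht]
  have hβC : ∀ k, β (eC k) = (M : ℝ) ^ (k : ℕ) := fun k => by
    simp only [β, if_neg (heCmem k), βC, hιC.extend_apply]
  have hMpos : 0 < M := by rw [hMdef]; omega
  have hβpos : ∀ j, 0 < β j := fun j => by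
    by_cases hj : j ∈ T
    · rw [hβT j hj]; exact_mod_cast (show 0 < L by rw [hLdef]; omega)
    · obtain ⟨k, rfl⟩ := heCsurj j hj
      rw [hβC]; positivity
  let wt : (Fin n → ℕ) → ℕ := fun a => L * (∑ t ∈ T, a t) + wdig (fun k => a (eC k))
  have hwt : ∀ a, weight β a = (wt a : ℝ) := by
    intro a
    unfold weight
    rw [← Finset.sum_add_sum_compl T]
    have h1 : ∑ j ∈ T, β j * (a j : ℝ) = (L : ℝ) * ∑ t ∈ T, (a t : ℝ) := by
      rw [Finset.mul_sum]
      exact Finset.sum_congr rfl fun j hj => by rw [hβT j hj]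
    have h2 : ∑ j ∈ Tᶜ, β j * (a j : ℝ) = ∑ k : Fin Tᶜ.card, (M : ℝ) ^ (k : ℕ) * (a (eC k) : ℝ) := by
      rw [← Finset.sum_coe_sort Tᶜ]
      exact (Fintype.sum_equiv (Tᶜ.orderIsoOfFin rfl).toEquiv _ _ fun k => by
        simp only [OrderIso.coe_toEquiv, Finset.coe_orderIsoOfFin_apply, ← heC, hβC]).symm
    rw [h1, h2]
    simp only [wt, wdig, Nat.cast_add, Nat.cast_mul, Nat.cast_sum, Nat.cast_pow]
    congr 1
    exact Finset.sum_congr rfl fun k _ => by ring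
  have hwt_ext : ∀ a, wt (ext a) = wdig a := fun a => by
    simp only [wt, hextC]
    rw [Finset.sum_eq_zero (fun t ht => hextT a t ht), mul_zero, zero_add]
  -- the monomial filtration and the key memberships
  have hβ0 : ∀ j, 0 ≤ β j := fun j => (hβpos j).le
  have hJanti : ∀ {a b : ℝ}, a ≤ b → monomialIdeal u β b ≤ monomialIdeal u β a := fun hab => monomialIdeal_antitone u β hab
  have h𝔭L : 𝔭 ≤ monomialIdeal u β L := by
    rw [h𝔭, hzr, Ideal.span_le]
    rintro _ ⟨t, ht, rfl⟩
    rw [SetLike.mem_coe, ← uPow_single u t]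
    refine uPow_mem_monomialIdeal u ?_
    rw [weight_single, hβT t (Finset.mem_coe.mp ht)]
  set xt : Fin n → ℕ := ext x' with hxt
  have hwxt : weight β xt = (w : ℝ) := by rw [hwt, hxt, hwt_ext]
  have hUx : ∀ i : ℕ, uPow u (i • xt) ∈ monomialIdeal u β ((i : ℝ) * w) := fun i =>
    uPow_mem_monomialIdeal u (by rw [weight_nsmul, hwxt])
  have hUa : ∀ a ∈ Λ, a ≠ x' → uPow u (ext a) ∈ monomialIdeal u β ((w : ℝ) + 1) := fun a ha hne =>
    uPow_mem_monomialIdeal u (by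
      rw [hwt, hwt_ext]
      exact_mod_cast Nat.succ_le_of_lt (hx'uniq a ha hne))
  have hLw : ((w : ℝ) + 1) ≤ (L : ℝ) := by
    rw [hLdef]; push_cast; nlinarith [show (1 : ℝ) ≤ m by exact_mod_cast hm, show (0 : ℝ) ≤ w by positivity]
  have hρ : lam - c * uPow u xt ∈ monomialIdeal u β ((w : ℝ) + 1) := by
    have h1 : lam - c * uPow u xt = (lam - ∑ a ∈ Λ, γ a * uPow u (ext a)) + ∑ a ∈ Λ.erase x', γ a * uPow u (ext a) := by
      rw [← Finset.add_sum_erase _ _ hx'Λ, hcdef, hxt]; ring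
    rw [h1]
    refine Ideal.add_mem _ (hJanti hLw (h𝔭L hlamdec)) (Ideal.sum_mem _ fun a ha => ?_)
    obtain ⟨hne, haΛ⟩ := Finset.mem_erase.mp ha
    exact Ideal.mul_mem_left _ _ (hUa a haΛ hne)
  have hlamw : lam ∈ monomialIdeal u β (w : ℝ) := by
    have : lam = (lam - c * uPow u xt) + c * uPow u xt := by ring
    rw [this]
    refine Ideal.add_mem _ (hJanti (by linarith) hρ) (Ideal.mul_mem_left _ _ ?_)
    have := hUx 1; rwa [one_smul, Nat.cast_one, one_mul] at this
  have hpow : ∀ i : ℕ, lam ^ i - c ^ i * uPow u (i • xt) ∈ monomialIdeal u β ((i : ℝ) * w + 1) := by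
    intro i
    induction i with
    | zero => simp
    | succ i ih =>
      have h1 : lam ^ (i + 1) - c ^ (i + 1) * uPow u ((i + 1) • xt) =
          lam * (lam ^ i - c ^ i * uPow u (i • xt)) + (c ^ i * uPow u (i • xt)) * (lam - c * uPow u xt) := by
        rw [succ_nsmul, uPow_add]; ring
      rw [h1]
      refine Ideal.add_mem _ ?_ ?_
      · have := mul_mem_monomialIdeal_add hlamw ih
        refine hJanti ?_ this
        push_cast; ring_nf; exact le_rfl
      · have := mul_mem_monomialIdeal_add (Ideal.mul_mem_left _ (c ^ i) (hUx i)) hρ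
        refine hJanti ?_ this
        push_cast; ring_nf; exact le_rfl
  -- every coefficient: `f_j ≡ C(m,j)(−c)^j u^{j xt}` modulo weight `> j w`
  have hfj : ∀ j ∈ Finset.Icc 1 m, h.coeff (m - j) - (m.choose j : R) * (-c) ^ j * uPow u (j • xt) ∈
      monomialIdeal u β (((wt (j • xt) : ℕ) : ℝ) + 1) := by
    intro j hj
    have hj' := Finset.mem_Icc.mp hj
    have hwj : ((wt (j • xt) : ℕ) : ℝ) = (j : ℝ) * w := by rw [← hwt, weight_nsmul, hwxt]
    rw [hwj]
    have h1 := hcoef j hj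
    have h2 : (m.choose j : R) * (-lam) ^ j - (m.choose j : R) * (-c) ^ j * uPow u (j • xt) =
        (m.choose j : R) * (-1) ^ j * (lam ^ j - c ^ j * uPow u (j • xt)) := by
      rw [neg_pow lam, neg_pow c]; ring
    have h3 : (m.choose j : R) * (-lam) ^ j - (m.choose j : R) * (-c) ^ j * uPow u (j • xt) ∈ monomialIdeal u β ((j : ℝ) * w + 1) := by
      rw [h2]; exact Ideal.mul_mem_left _ _ (hpow j)
    have h4 : h.coeff (m - j) - (m.choose j : R) * (-lam) ^ j ∈ monomialIdeal u β ((j : ℝ) * w + 1) := by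
      refine hJanti ?_ (h𝔭L h1)
      rw [hLdef]; push_cast
      nlinarith [show (j : ℝ) ≤ m by exact_mod_cast hj'.2, show (0 : ℝ) ≤ w by positivity]
    have := Ideal.add_mem _ h4 h3
    rwa [sub_add_sub_cancel] at this
  -- per-coefficient facts
  have hcase : ∀ j ∈ Finset.Icc 1 m,
      ((m.choose j : R) = 0 ∧ ∀ a ∈ minExponents u (h.coeff (m - j)), ((j : ℝ) * w + 1) ≤ weight β a) ∨
      (IsUnit ((m.choose j : R) * (-c) ^ j) ∧ (j • xt) ∈ minExponents u (h.coeff (m - j)) ∧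
        (∀ a ∈ minExponents u (h.coeff (m - j)), a ≠ j • xt → ((j : ℝ) * w + 1) ≤ weight β a) ∧
        coeffClass u (h.coeff (m - j)) (j • xt) = Ideal.Quotient.mk _ ((m.choose j : R) * (-c) ^ j)) := by
    intro j hj
    have hwj : ((wt (j • xt) : ℕ) : ℝ) = (j : ℝ) * w := by rw [← hwt, weight_nsmul, hwxt]
    by_cases hCj : (m.choose j : R) = 0
    · left
      refine ⟨hCj, ?_⟩
      have hf0 : h.coeff (m - j) ∈ monomialIdeal u β ((j : ℝ) * w + 1) := by
        have := hfj j hj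
        rwa [hCj, zero_mul, zero_mul, sub_zero, hwj] at this
      obtain ⟨-, hmemj, hrefj⟩ := hzu.minExponents_spec (h.coeff (m - j))
      exact (mem_monomialIdeal_iff_of_minimal u hβ0 hmemj hrefj).mp hf0
    · right
      have hunit : IsUnit ((m.choose j : R) * (-c) ^ j) := (hchar _ hCj).mul (hcunit.neg.pow j)
      obtain ⟨h1, h2, h3⟩ := mem_minExponents_of_sub_mem_monomialIdeal hzu hβpos wt hwt hunit (j • xt) (hfj j hj)
      refine ⟨hunit, h1, fun a ha hne => ?_, h3⟩
      rw [← hwj]; exact h2 a ha hne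
  -- the solvable vertex `xt`
  refine hmin xt ⟨⟨β, hβpos, ?_, ?_⟩, c, ?_⟩
  · intro j hj a ha
    have hj' := Finset.mem_Icc.mp hj
    have hjpos : (0 : ℝ) < j := by exact_mod_cast hj'.1
    have hwx : ∑ l, β l * ((xt l : ℕ) : ℝ) = w := hwxt
    rw [hwx]
    have hfar : ∀ {a : Fin n → ℕ}, ((j : ℝ) * w + 1) ≤ weight β a → (w : ℝ) ≤ weight β a / j ∧
        (weight β a / j = w → (fun l => (a l : ℝ) / j) = fun l => ((xt l : ℕ) : ℝ)) := by
      intro a hle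
      have hlt : (w : ℝ) < weight β a / j := by
        rw [lt_div_iff₀ hjpos]; linarith
      exact ⟨hlt.le, fun heq => absurd heq hlt.ne'⟩
    rcases hcase j hj with ⟨-, hall⟩ | ⟨-, -, hother, -⟩
    · exact hfar (hall a ha)
    · by_cases hax : a = j • xt
      · subst hax
        have hwa : weight β (j • xt) / j = w := by
          rw [weight_nsmul, hwxt]
          field_simp
        refine ⟨hwa.ge, fun _ => ?_⟩
        funext l
        simp only [Pi.smul_apply, smul_eq_mul, Nat.cast_mul]
        field_simp
      · exact hfar (hother a ha hax)
  · refine ⟨m, Finset.mem_Icc.mpr ⟨hm, le_rfl⟩, m • xt, ?_, ?_⟩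
    · rcases hcase m (Finset.mem_Icc.mpr ⟨hm, le_rfl⟩) with ⟨h0, -⟩ | ⟨-, hmemj, -, -⟩
      · exfalso
        rw [Nat.choose_self, Nat.cast_one] at h0
        exact one_ne_zero h0
      · exact hmemj
    · have hmpos : (0 : ℝ) < m := by exact_mod_cast hm
      funext l
      simp only [Pi.smul_apply, smul_eq_mul, Nat.cast_mul]
      field_simp
  · intro j hj
    rcases hcase j hj with ⟨h0, hall⟩ | ⟨-, -, -, hcc⟩
    · rw [h0, zero_mul, map_zero]
      apply coeffClass_eq_zero_of_not_mem
      intro hmemj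
      have := hall _ hmemj
      rw [weight_nsmul, hwxt] at this
      linarith
    · exact hcc

end Main

end Summit.ResolutionOfSingularities.ResolutionOfSingularities.Theorems.SigmaMaxModificationsCorridor3.Helpers

end
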